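import Summits.QuantumFields.YangMills.Theorems.LangevinControlUVFemtoCurvatureTwoPointCDoublingDefs
import HarnessLib

/-!
# Sublevel doubling of Wilson's action on a fixed torus `(ℤ/L)^d`, EVERY dimension `d` — vocabulary

Crux `HistoryTailL` (stmt-QuantumFields-19936), level-0 lane (T4) «uniform doubling» of the cell `ym3-torus` (rung R3: continuum
SU(2) Yang–Mills on the 3-torus; NOT d = 4, NOT infinite volume, NOT a mass gap, NOT the Clay problem). The γ-uniform form of the
level-0 exponential plaquette moment needs the doubling `Z_L(b/2) ≤ e^{A L³} Z_L(b)` of the Wilson partition function on `(ℤ/L)³`,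
whose holonomy-conditioned sandwich (`…LocalInsertionTorusLowerAxisHolonomy`, `…LocalInsertionTorusUpperAxisD3`) reduces it to the
ONE-SITE doubling on `G³`, i.e. to the doubling of the sublevel volumes `Haar^E{S ≤ t}` of Wilson's action on the one-site torus
`(ℤ/1)³`. Route `LangevinControlUV` (crux `FemtoCurvatureTwoPointC`, line `Sketch` v7) proved that sublevel doubling on `(ℤ/L)^d` with
the dimension as a LITERAL `4` (`…CDoublingDefs/Koszul/Plaquette/ConePointwise/Cone/Cover/Sublevel`, `…CStubSliceLoc/Open`); the files
`LocalInsertionSublevelDoubling*` are the `{d : ℕ}`-generic port of that conical package (zero modes = Koszul `H¹`; commutators vs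
brackets; cone in the exponential gauge slice; co-Lipschitz scaling; open tube; finite cover), instantiated at `d = 3`, `L = 1` at the
end. This file holds the d-generic DEFINITIONS (the d-free fibre `Fib r` and `Ad` in coordinates `adFib r g` are IMPORTED from
`…CDoublingDefs`, not copied):

* `SiteFun r d L`, `OneForm r d L` — `𝔤`-valued site functions / 1-forms on `(ℤ/L)^d` as `L²` spaces (`PiLp 2`);
* `transport r τ i` — `(S_i f)(x) = Ad r(τ(x,i)) f(x + e_i)`; `dZero r τ` — `(d⁰η)(x,i) = η(x) − (S_i η)(x)`; `comp A i` — the `i`-th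
  component of a 1-form; `dOne r τ A i j = T_i A_j − T_j A_i` (`T = S − 1`, linearised curvature);
* `zeroModes r τ = ⋂ ker T_i`, `constForms`, `slice r τ = (range d⁰)ᗮ`, `massive = slice ⊓ constFormsᗮ`;
* `cfg r τ A (x,i) = expChart r.ρ (A(x,i)) · τ(x,i)` — the exponential chart at `τ`; `gaugeExp r η`; `rot r k`;
* `tube r τ δ`, `scaleMap r τ δ s` — the gauge tube and the scaling map on it;
* `commForm r c = Σ_{x,i,j} ‖[lieIso c(x,i), lieIso c(x,j)]‖²` — the quartic commutator form.

Adapted verbatim (literal `4` ↦ `d`) from `Theorems/LangevinControlUVFemtoCurvatureTwoPointCDoublingDefs.lean`. References: Hall, *Lie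
Groups, Lie Algebras, and Representations* (2015) Thm. 3.20, Cor. 3.44 (exponential chart, `Ad`-stability).
-/

set_option autoImplicit false

noncomputable section

open scoped Matrix Matrix.Norms.Frobenius InnerProductSpace
open NormedSpace
open Literature.MathematicalPhysics.QuantumLattice Literature.MathematicalPhysics.QuantumFieldTheory
open Summit.QuantumFields.YangMills.Theorems.FreeEnergyLogCoefficient
open Summit.QuantumFields.YangMills.Theorems.FemtoCurvatureTwoPointC.Doubling (Fib adFib lieIso_adFib adFib_mul adFib_one
  adFib_inv_apply adFib_apply_inv inner_adFib)

namespace Summit.QuantumFields.YangMills.Theorems.LocalInsertion.SublevelDoubling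

variable {G : Type} [Group G] [TopologicalSpace G] [CompactSpace G]

/-! ### Site functions, 1-forms, flatness -/

/-- `𝔤`-valued site functions on the torus `(ℤ/L)^d`, as an `L²` (finite-dimensional real inner product) space. -/
abbrev SiteFun (r : LatticeRep G) (d L : ℕ) : Type := PiLp 2 (fun _ : Site d L => Fib r)

/-- `𝔤`-valued 1-forms (edge functions) on the torus `(ℤ/L)^d`, as an `L²` space. -/
abbrev OneForm (r : LatticeRep G) (d L : ℕ) : Type := PiLp 2 (fun _ : Edge d L => Fib r)

variable (r : LatticeRep G) {d L : ℕ}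

section Components

omit [CompactSpace G]

/-- The `i`-th component of a 1-form as a site function: `(comp A i)(x) = A(x,i)`. -/
def comp (A : OneForm r d L) (i : Fin d) : SiteFun r d L := WithLp.toLp 2 fun x => A (x, i)

/-- Pointwise formula for `comp`. -/
@[simp] theorem comp_apply (A : OneForm r d L) (i : Fin d) (x : Site d L) : comp r A i x = A (x, i) := rfl

/-- `comp` as a linear map in the 1-form. -/
def compₗ (i : Fin d) : OneForm r d L →ₗ[ℝ] SiteFun r d L where
  toFun A := comp r A i
  map_add' A B := by ext x; simp
  map_smul' c A := by ext x; simp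

/-- `compₗ i A = comp A i`. -/
@[simp] theorem compₗ_apply (i : Fin d) (A : OneForm r d L) : compₗ r i A = comp r A i := rfl

end Components

/-- **Parallel transport** of site functions along direction `i` at the configuration `τ`:
`(S_i f)(x) = Ad r(τ(x,i)) f(x + e_i)`. At a flat `τ` these commute pairwise (proved in the Koszul file). -/
def transport (τ : GaugeConfig d L G) (i : Fin d) : SiteFun r d L →ₗ[ℝ] SiteFun r d L where
  toFun f := WithLp.toLp 2 fun x => adFib r (τ (x, i)) (f (x.shift i))
  map_add' f g := by ext x; simp
  map_smul' c f := by ext x; simp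

/-- Pointwise formula for `transport`. -/
@[simp] theorem transport_apply (τ : GaugeConfig d L G) (i : Fin d) (f : SiteFun r d L) (x : Site d L) :
    transport r τ i f x = adFib r (τ (x, i)) (f (x.shift i)) := rfl

/-- **Linearised gauge action** (`d⁰ = 1 − S` componentwise): `(d⁰η)(x,i) = η(x) − Ad r(τ(x,i)) η(x + e_i)`, the derivative at
`h = 1` of `h ↦ h(x) · (e^{A} τ)(x,i) · h(x+e_i)⁻¹` read on the left perturbation `A`. -/
def dZero (τ : GaugeConfig d L G) : SiteFun r d L →ₗ[ℝ] OneForm r d L where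
  toFun η := WithLp.toLp 2 fun e => η e.1 - adFib r (τ e) (η (e.1.shift e.2))
  map_add' η θ := PiLp.ext fun e => by
    simp only [PiLp.add_apply, map_add]; abel
  map_smul' c η := PiLp.ext fun e => by
    simp only [PiLp.smul_apply, LinearIsometry.map_smul, RingHom.id_apply, smul_sub]

/-- Pointwise formula for `dZero`. -/
@[simp] theorem dZero_apply (τ : GaugeConfig d L G) (η : SiteFun r d L) (x : Site d L) (i : Fin d) :
    dZero r τ η (x, i) = η x - adFib r (τ (x, i)) (η (x.shift i)) := rfl

/-- **Linearised curvature** (Koszul form): `(d¹A)_{ij} = T_i A_j − T_j A_i` with `T_i = S_i − 1`, i.e.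
`(d¹A)_{ij}(x) = (S_i A_j)(x) − A_j(x) − (S_j A_i)(x) + A_i(x)` — the first-order term of the plaquette holonomy of `e^{A} τ` at a flat
`τ` (plaquette file). -/
def dOne (τ : GaugeConfig d L G) (A : OneForm r d L) (i j : Fin d) : SiteFun r d L :=
  (transport r τ i (comp r A j) - comp r A j) - (transport r τ j (comp r A i) - comp r A i)

/-- Pointwise formula for `dOne`. -/
theorem dOne_apply (τ : GaugeConfig d L G) (A : OneForm r d L) (i j : Fin d) (x : Site d L) :
    dOne r τ A i j x =
      (adFib r (τ (x, i)) (A (x.shift i, j)) - A (x, j)) - (adFib r (τ (x, j)) (A (x.shift j, i)) - A (x, i)) := by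
  simp [dOne]

/-- `dOne` as a linear map in the 1-form, for fixed directions. -/
def dOneₗ (τ : GaugeConfig d L G) (i j : Fin d) : OneForm r d L →ₗ[ℝ] SiteFun r d L :=
  ((transport r τ i).comp (compₗ r j) - compₗ r j) - ((transport r τ j).comp (compₗ r i) - compₗ r i)

/-- `dOneₗ τ i j A = dOne τ A i j`. -/
@[simp] theorem dOneₗ_apply (τ : GaugeConfig d L G) (i j : Fin d) (A : OneForm r d L) :
    dOneₗ r τ i j A = dOne r τ A i j := rfl

/-! ### Zero modes, constant forms, the slice -/

/-- **Zero modes** at `τ`: site functions fixed by every transport, `W₀ = ⋂_i ker (S_i − 1)` (the Lie algebra of the stabiliser of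
`τ` in the gauge group; for the trivial configuration: the constant `𝔤`-valued functions). -/
def zeroModes (τ : GaugeConfig d L G) : Submodule ℝ (SiteFun r d L) :=
  ⨅ i : Fin d, LinearMap.ker (transport r τ i - LinearMap.id)

/-- Membership in `zeroModes`. -/
theorem mem_zeroModes_iff (τ : GaugeConfig d L G) (f : SiteFun r d L) :
    f ∈ zeroModes r τ ↔ ∀ i : Fin d, transport r τ i f = f := by
  simp [zeroModes, Submodule.mem_iInf, LinearMap.mem_ker, sub_eq_zero]

/-- **Constant forms**: 1-forms all of whose components are zero modes (`𝒞 = W₀^d`). -/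
def constForms (τ : GaugeConfig d L G) : Submodule ℝ (OneForm r d L) :=
  ⨅ i : Fin d, (zeroModes r τ).comap (compₗ r i)

/-- Membership in `constForms`. -/
theorem mem_constForms_iff (τ : GaugeConfig d L G) (A : OneForm r d L) :
    A ∈ constForms r τ ↔ ∀ i : Fin d, comp r A i ∈ zeroModes r τ := by
  simp [constForms, Submodule.mem_iInf]

/-! ### The chart at `τ`, gauge transformations, the commutator form -/

/-- **The exponential chart at `τ`** (left perturbation): `cfg τ A (x,i) = expChart r.ρ (A(x,i)) · τ(x,i)`, so that
`r.ρ (cfg τ A e) = exp (lieIso (A e)) · r.ρ (τ e)` and `cfg τ 0 = τ` for faithful `r`. -/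
def cfg (τ : GaugeConfig d L G) (A : OneForm r d L) : GaugeConfig d L G :=
  fun e => expChart r.ρ (A e) * τ e

/-- The gauge transformation `x ↦ expChart r.ρ (η x)` generated by a site function (`gaugeExp 0 = 1` for faithful `r`). -/
def gaugeExp (η : SiteFun r d L) : Site d L → G :=
  fun x => expChart r.ρ (η x)

section L2

variable [NeZero L]

/-- **The gauge slice** at `τ`: 1-forms orthogonal to the infinitesimal gauge orbit, `𝒴 = (range d⁰)ᗮ`. -/
def slice (τ : GaugeConfig d L G) : Submodule ℝ (OneForm r d L) :=
  (LinearMap.range (dZero r τ) : Submodule ℝ (OneForm r d L))ᗮ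

/-- **Massive directions**: slice forms orthogonal to the constant forms, `𝒩 = 𝒴 ⊓ 𝒞ᗮ` (on which the linearised curvature is
injective at a flat `τ`, Koszul file). -/
def massive (τ : GaugeConfig d L G) : Submodule ℝ (OneForm r d L) :=
  slice r τ ⊓ (constForms r τ : Submodule ℝ (OneForm r d L))ᗮ

/-- **Rotation of 1-forms by a gauge transformation**: `(rot k A)(x,i) = Ad r(k x) A(x,i)` — how the stabiliser of `τ` acts on the
chart coordinate (`gaugeTransform k (cfg τ A) = cfg τ (rot k A)` for `k ∈ Stab τ`, plaquette file). A linear isometry. -/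
def rot (k : Site d L → G) : OneForm r d L →ₗᵢ[ℝ] OneForm r d L where
  toFun A := WithLp.toLp 2 fun e => adFib r (k e.1) (A e)
  map_add' A B := by ext e; simp
  map_smul' c A := by ext e; simp
  norm_map' A := by
    rw [PiLp.norm_eq_of_L2, PiLp.norm_eq_of_L2]
    simp

/-- Pointwise formula for `rot`. -/
@[simp] theorem rot_apply (k : Site d L → G) (A : OneForm r d L) (e : Edge d L) : rot r k A e = adFib r (k e.1) (A e) := rfl

/-- **The gauge tube** of radius `δ` around `τ`: gauge transforms of chart points over slice forms of norm `< δ`,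
`{h · cfg τ A : h ∈ G^V, A ∈ 𝒴, ‖A‖ < δ}` (for small `δ` it contains a neighbourhood of `τ`, slice file). -/
def tube (τ : GaugeConfig d L G) (δ : ℝ) : Set (GaugeConfig d L G) :=
  {U | ∃ (h : Site d L → G) (A : OneForm r d L), A ∈ slice r τ ∧ ‖A‖ < δ ∧ U = gaugeTransform h (cfg r τ A)}

open Classical in
/-- **The scaling map** `Φ_s` on the gauge tube: `Φ_s(h · cfg τ A) = h · cfg τ (s • A)` (a representative `(h, A)` is CHOSEN; the
slice file shows the value does not depend on the choice for small `δ`), extended by the identity off the tube. -/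
def scaleMap (τ : GaugeConfig d L G) (δ s : ℝ) (U : GaugeConfig d L G) : GaugeConfig d L G :=
  if hU : U ∈ tube r τ δ then gaugeTransform hU.choose (cfg r τ (s • hU.choose_spec.choose)) else U

/-- Off the tube the scaling map is the identity. -/
theorem scaleMap_of_not_mem (τ : GaugeConfig d L G) (δ s : ℝ) {U : GaugeConfig d L G} (hU : U ∉ tube r τ δ) :
    scaleMap r τ δ s U = U := by
  simp [scaleMap, hU]

/-- On the tube the scaling map is `h · cfg τ (s • A)` for SOME representative `(h, A)` of `U = h · cfg τ A`. -/
theorem exists_scaleMap_eq (τ : GaugeConfig d L G) (δ s : ℝ) {U : GaugeConfig d L G} (hU : U ∈ tube r τ δ) :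
    ∃ (h : Site d L → G) (A : OneForm r d L), A ∈ slice r τ ∧ ‖A‖ < δ ∧ U = gaugeTransform h (cfg r τ A) ∧
      scaleMap r τ δ s U = gaugeTransform h (cfg r τ (s • A)) := by
  classical
  refine ⟨hU.choose, hU.choose_spec.choose, hU.choose_spec.choose_spec.1, hU.choose_spec.choose_spec.2.1,
    hU.choose_spec.choose_spec.2.2, ?_⟩
  simp [scaleMap, hU]

omit [CompactSpace G] in
/-- **The quartic commutator form of a 1-form** (used on constant forms): `Q(c) = Σ_{x,i,j} ‖[lieIso c(x,i), lieIso c(x,j)]‖²`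
(Frobenius norm; each unordered pair counted twice, diagonal terms vanish). Homogeneous of degree `4`. -/
def commForm (c : OneForm r d L) : ℝ :=
  ∑ x : Site d L, ∑ i : Fin d, ∑ j : Fin d,
    ‖lieIso r.ρ (c (x, i)) * lieIso r.ρ (c (x, j)) - lieIso r.ρ (c (x, j)) * lieIso r.ρ (c (x, i))‖ ^ 2

omit [CompactSpace G] in
/-- `commForm` is non-negative. -/
theorem commForm_nonneg (c : OneForm r d L) : 0 ≤ commForm r c :=
  Finset.sum_nonneg fun _ _ => Finset.sum_nonneg fun _ _ => Finset.sum_nonneg fun _ _ => sq_nonneg _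

omit [CompactSpace G] in
/-- **Homogeneity**: `Q(s • c) = s⁴ Q(c)`. -/
theorem commForm_smul (s : ℝ) (c : OneForm r d L) : commForm r (s • c) = s ^ 4 * commForm r c := by
  simp only [commForm, PiLp.smul_apply, LinearIsometry.map_smul, Matrix.smul_mul, Matrix.mul_smul, smul_smul,
    ← smul_sub, norm_smul, Real.norm_eq_abs, mul_pow, Finset.mul_sum]
  refine Finset.sum_congr rfl fun x _ => Finset.sum_congr rfl fun i _ => Finset.sum_congr rfl fun j _ => ?_
  rw [show |s * s| ^ 2 = s ^ 4 by rw [abs_mul_self, ← sq]; ring]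

end L2

end Summit.QuantumFields.YangMills.Theorems.LocalInsertion.SublevelDoubling

end
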